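import Summits.CriticalPhenomena.Ising3D.Control2DReadoutSpinKernel
import Summits.CriticalPhenomena.Ising3D.Control2DL19BoxXTable
import Mathlib.Tactic.NormNum
import HarnessLib

/-!
# Readout certificate B19, SPIN-4 channel: the first `ℓ = 4` near-zero above the unitarity edge of the Λ = 19 lower-edge box functional sits
at `Δ = 5.10` (`± 0.04`), displaced from the 2D Ising spin-4 level `Δ = 5` by `δ₄(19) = 0.10` — KERNEL (cell `pub-ising3x`, seat controls-1
gen 30; certificate kind "readout", spin extension; `HOME/STRUCTURE.md` §2 C-F / E-3 — CONTROL-ONLY)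

HONEST FRAMING: lottery ticket; floor = tightest certified 3D Ising CFT bounds; no exact-solution
claim without a proof. CONTROL-ONLY (`d = 2`, `Δ_σ = 1/8`, the 2D Ising control; axiom set `A2D′`); nothing about `d = 3`.
This is a statement about one of our INSTRUMENTS (a certified edge functional), not about a CFT.

Object: the kernel table `wtboxX` on `slL19` (RB-7 `j141725` (Λ = 19, E₀ = 48; box `[197/200, 99/100]`; the typed functional `edgeB19`)). Under `A2D′` spin-4 blocks are constrained only by unitarity `Δ ≥ 4`
(`BoxObligations.spinning_nonneg`); in the 2D Ising `σ × σ` OPE the spin-4 quasi-primaries are the twist-0 current `(4, 0)` at that edge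
and then `(9/2, 1/2)` at `Δ = 5`, `(6, 2)` at `Δ = 8`, …; E-3 reads the first `ℓ = 4` near-zero above the edge at `5.21 / 5.21 / 5.10` for
Λ = 13 / 15 / 19 ("true 5"; not resolved at Λ = 11). Claim, re-decided in the Lean kernel from exact rationals
(`Control2DReadoutSpinKernel.readoutCheckSpin`: fast `u`-vectors at `N = 160` levels for the weight pair `(h, h̄) = (Δ/2 + 2, Δ/2 - 2)`, room
`k = 1` (`Δ ≤ 6`), the two-sided tail bound `abs_phi_block_sub_QN_le_spin`): the spin-4 action `f(Δ) = φ[F^{1/8}_-[g_{Δ,4}]]` sampled at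
`Δ ∈ {5, 5.06, 5.10, 5.14}` is STRICTLY SMALLEST at `5.10`: `f(5.10) < f(a)`, `f(5.10) < f(b)`, `f(5.10) < f(5)` (`dip4_B19`) — a
`DisplacedDip φ (1/8) 4 5 a m b` statement in the vocabulary of `Control2DConjectureCF`; the bracket is `± 0.04` in this channel (the spin-4 dips are
shallower than the spin-0/2 ones at low Λ; the check's right-bracket clause carries a factor-2 slack). E-3's 80-digit evaluators read this dip at `5.10`.
Certified margins (lower-bound ratios `L(a)/U(m)`, `L(b)/2U(m)`, `L(5)/U(m)`; exact Python mirror `checkmirror_spin.py`): 4.8 / 2.8 / 21.9; enclosure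
radius / value at the dip ≤ 2e-7. Zero grant compute. No facts, standard axioms only. [cite: RattazziEtAl2008, §5.5]
-/

namespace Summit.CriticalPhenomena.Ising3D.Control2D

open Literature.MathematicalPhysics.QuantumFieldTheory.ConformalBootstrap3D

set_option maxHeartbeats 0 in
/-- The spin-4 readout check of B19 PASSES in the kernel (`N = 160`, `k = 1`; true level `5`, bracket `5.06, 5.10, 5.14`). [folklore] -/
theorem readoutCheckSpin4_B19 : readoutCheckSpin wtboxX slL19 19 160 4 1 5 (253 / 50) (51 / 10) (257 / 50) = true := by
  decide +kernel

set_option maxRecDepth 8192 in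
/-- **Readout B19, spin-4 channel, kernel-complete**: for `φ = taylorFunctional2D (1/2) slL19 wtboxX` (`Δ_σ = 1/8`, `ℓ = 4`),
`f(5.10) < f(a)`, `f(5.10) < f(b)`, `f(5.10) < f(5)` with the bracket `a, b = 5.10 ∓ 0.04` — the first spin-4 near-zero above the unitarity
edge is displaced ABOVE the 2D Ising level `Δ = 5` by `δ₄(19) = 0.10 ± 0.04`. CONTROL-ONLY (d = 2). [cite: RattazziEtAl2008, §5.5] -/
theorem dip4_B19 :
    taylorFunctional2D (1 / 2) slL19.toFinset (fun p => (wtboxX p : ℝ)) (crossF (1 / 8) (-1) (globalBlock (51 / 10) 4)) <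
        taylorFunctional2D (1 / 2) slL19.toFinset (fun p => (wtboxX p : ℝ)) (crossF (1 / 8) (-1) (globalBlock (253 / 50) 4)) ∧
      taylorFunctional2D (1 / 2) slL19.toFinset (fun p => (wtboxX p : ℝ)) (crossF (1 / 8) (-1) (globalBlock (51 / 10) 4)) <
        taylorFunctional2D (1 / 2) slL19.toFinset (fun p => (wtboxX p : ℝ)) (crossF (1 / 8) (-1) (globalBlock (257 / 50) 4)) ∧
      taylorFunctional2D (1 / 2) slL19.toFinset (fun p => (wtboxX p : ℝ)) (crossF (1 / 8) (-1) (globalBlock (51 / 10) 4)) <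
        taylorFunctional2D (1 / 2) slL19.toFinset (fun p => (wtboxX p : ℝ)) (crossF (1 / 8) (-1) (globalBlock 5 4)) := by
  have h := dip_of_readoutCheckSpin wtboxX slL19_nodup slL19_deg readoutCheckSpin4_B19
  have e1 : ((51 / 10 : ℚ) : ℝ) = 51 / 10 := by norm_num
  have e2 : ((253 / 50 : ℚ) : ℝ) = 253 / 50 := by norm_num
  have e3 : ((257 / 50 : ℚ) : ℝ) = 257 / 50 := by norm_num
  have e4 : ((5 : ℚ) : ℝ) = 5 := by norm_num
  rw [e1, e2, e3, e4] at h
  exact h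

end Summit.CriticalPhenomena.Ising3D.Control2D
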